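import Summits.KontsevichZagierPeriods.Zeta5Search.BigPrimePoles
import HarnessLib

/-!
# The `ζ(5)`-coefficient on the face `b₁ = b₂ = N/2` in closed form: `Ω₀ = U(b)` (cell `pub-zeta5`, P1)

HONEST FRAMING: systematic search; no irrationality claim unless certified.

OUR work (Summit side, P1 seat generation 4), completing the face case of planner gen-1 g6's level descent
(`WedgeDictionaryLevelDescentFace`: the weight of the degenerate series is `U(b)`; gen-1 observed `Ω₀(b) = U(b)` 60/60).
On the face `b = (2h; h, h, b₃, …, b₇)` the summand is `R_b = 2(X+h)·P(X)²·Q(X)/((X)_{N+1})⁶` with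
`P = ∏_{s ≤ N, s ≠ h} (X + s)` and `Q = ∏_{j=3}^{7} (X)_{b_j}(X+N−b_j+1)_{b_j}` (`numPoly_face_eq`): every pole `−p`,
`p ≠ h`, has order `≤ 4` and the pole `−h` has order exactly `5`.  Through typer g7's Taylor identity at a pole
(`BigPrime.taylor_numPoly_congr`: `numPoly_b(X − p) ≡ (Σ_o c_{o,p}X^{5−o})·E_p (mod X⁶)`) the two top
partial-fraction coefficients are the value and the derivative of `numPoly_b` at `−p` (`pf_top_coeffs`), whence
(`coeffU_face_closed`):

  `U(b) = c_{4,h} = 2 · Q(−h) / P(−h)⁴`,  `P(−h) = ∏_{s ≤ N, s ≠ h} (s − h)`,  `Q(−h) = ∏_{j=3}^{7} (−h)_{b_j} (h − b_j + 1)_{b_j}`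

— in factorials `U(b) = 2(−1)^{Σ_{j≥3} b_j} ∏_{j=3}^{7} (h!/(h−b_j)!)² / (h!)⁸`, gen-1's `Ω₀(b)` on the face.
No irrationality content (a rational number in closed form).
-/

open Finset Polynomial

namespace Summit.KontsevichZagierPeriods.Zeta5Search.WedgeDictionary

open Summit.KontsevichZagierPeriods.Zeta5Search.DualSeries
open Summit.KontsevichZagierPeriods.Zeta5Search.BigPrime (ER e0Z taylor_numPoly_congr coeff_eq_of_X_pow_dvd_sub
  ER_map ER_coeff_zero e0Z_ne_zero)
open Literature.NumberTheory.Transcendental.BallRivoal (pochPoly eval_pochPoly poch)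

namespace LevelDescent

/-! ### The two top partial-fraction coefficients at a pole -/

/-- Coefficients of `S = Σ_{o<6} c_{o,q} X^{5−o}`. -/
theorem coeff_S (c : ℕ → ℕ → ℚ) (q k : ℕ) (hk : k < 6) :
    (∑ o ∈ range 6, C (c o q) * X ^ (5 - o)).coeff k = c (5 - k) q := by
  rw [finsetSum_coeff, sum_eq_single (5 - k)]
  · rw [coeff_C_mul, coeff_X_pow, if_pos (by omega), mul_one]
  · intro o ho hne
    have := mem_range.1 ho
    simp only [coeff_C_mul, coeff_X_pow]
    rw [if_neg (by omega), mul_zero]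
  · intro h; exact absurd (mem_range.2 (by omega)) h

/-- **Top coefficients at a pole.** For partial-fraction data `c` of `R_b` and a pole index `q ≤ N`:
`c_{5,q}·e₀(q) = numPoly_b(−q)` and `c_{4,q}·e₀(q) + c_{5,q}·[X¹]E_q = numPoly_b′(−q)`. -/
theorem pf_top_coeffs (b : ℕ → ℤ) {c : ℕ → ℕ → ℚ} (hc : IsPFData b c) {q : ℕ} (hq : q ≤ (b 0).toNat) :
    c 5 q * ((e0Z (b 0).toNat q : ℤ) : ℚ) = (numPoly b).eval (-(q : ℚ)) ∧
    c 4 q * ((e0Z (b 0).toNat q : ℤ) : ℚ) + c 5 q * (ER ℚ (b 0).toNat q).coeff 1 =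
      (derivative (numPoly b)).eval (-(q : ℚ)) := by
  set n := (b 0).toNat with hn
  have h := taylor_numPoly_congr b hc hq
  have he0 : (ER ℚ n q).coeff 0 = ((e0Z n q : ℤ) : ℚ) := by
    rw [← ER_map (Int.castRingHom ℚ), coeff_map, ER_coeff_zero]; simp
  have h0 := coeff_eq_of_X_pow_dvd_sub h (show 0 < 6 by norm_num)
  have h1 := coeff_eq_of_X_pow_dvd_sub h (show 1 < 6 by norm_num)
  rw [taylor_coeff_zero, coeff_mul, Finset.Nat.sum_antidiagonal_eq_sum_range_succ_mk, sum_range_succ,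
    sum_range_zero, zero_add, Nat.sub_zero, coeff_S c q 0 (by norm_num), he0] at h0
  rw [taylor_coeff_one, coeff_mul, Finset.Nat.sum_antidiagonal_eq_sum_range_succ_mk, sum_range_succ,
    sum_range_succ, sum_range_zero, zero_add, Nat.sub_zero, Nat.sub_self, coeff_S c q 0 (by norm_num),
    coeff_S c q 1 (by norm_num), he0] at h1
  exact ⟨h0.symm, by linear_combination -h1⟩

/-! ### The face numerator `2(X+h)·P²·Q` -/

/-- `P = ∏_{s ≤ 2h, s ≠ h} (X + s)`. -/
noncomputable def Pface (h : ℕ) : ℚ[X] := ∏ s ∈ (range (2 * h + 1)).erase h, (X + C (s : ℚ))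

/-- The two special slots: `(X)_h · (X+h+1)_h = P`. -/
theorem slot_half_eq_Pface (h : ℕ) : pochPoly 0 h * pochPoly ((h : ℚ) + 1) h = Pface h := by
  have hsplit : (∏ s ∈ range (2 * h + 1), (X + C (s : ℚ))) =
      (∏ s ∈ range h, (X + C (s : ℚ))) * ((X + C (h : ℚ)) * ∏ s ∈ Ico (h + 1) (2 * h + 1), (X + C (s : ℚ))) := by
    rw [← prod_range_mul_prod_Ico _ (show h ≤ 2 * h + 1 by omega), prod_eq_prod_Ico_succ_bot (show h < 2 * h + 1 by omega)]
  have herase := mul_prod_erase (range (2 * h + 1)) (fun s => (X + C (s : ℚ))) (mem_range.2 (by omega) : h ∈ _)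
  have hne : (X + C (h : ℚ)) ≠ 0 := X_add_C_ne_zero _
  have key : (X + C (h : ℚ)) * Pface h = (X + C (h : ℚ)) * (pochPoly 0 h * pochPoly ((h : ℚ) + 1) h) := by
    rw [Pface, herase, hsplit]
    have e1 : pochPoly 0 h = ∏ s ∈ range h, (X + C (s : ℚ)) := by
      unfold pochPoly; exact prod_congr rfl fun s _ => by rw [zero_add]
    have e2 : pochPoly ((h : ℚ) + 1) h = ∏ s ∈ Ico (h + 1) (2 * h + 1), (X + C (s : ℚ)) := by
      rw [prod_Ico_eq_prod_range, show 2 * h + 1 - (h + 1) = h by omega]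
      unfold pochPoly
      exact prod_congr rfl fun s _ => by push_cast; ring_nf
    rw [e1, e2]; ring
  exact (mul_left_cancel₀ hne key).symm

/-- **The face numerator**: for `b₂ = b₁ = h`, `b₀ = 2h`:
`numPoly b = 2(X + h) · P² · ∏_{k<5} (X)_{b_{k+3}} (X + 2h − b_{k+3} + 1)_{b_{k+3}}`. -/
theorem numPoly_face_eq (b : ℕ → ℤ) (h12 : b 2 = b 1) (h11 : 2 * b 1 = b 0) (hb1 : 0 ≤ b 1) :
    numPoly b = C (2 : ℚ) * (X + C (((b 1).toNat : ℕ) : ℚ)) * Pface (b 1).toNat ^ 2 *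
      ∏ k ∈ range 5, pochPoly 0 (b (k + 1 + 1 + 1)).toNat *
        pochPoly ((b 0 - b (k + 1 + 1 + 1) + 1 : ℤ) : ℚ) (b (k + 1 + 1 + 1)).toNat := by
  set h := (b 1).toNat with hh
  have hhz : ((h : ℕ) : ℤ) = b 1 := Int.toNat_of_nonneg hb1
  have hsplit : ∀ F : ℕ → ℚ[X], ∏ j ∈ range 7, F j = F 0 * F (0 + 1) * ∏ k ∈ range 5, F (k + 1 + 1) := by
    intro F; rw [prod_range_succ' _ 6, prod_range_succ' _ 5]; ring
  unfold numPoly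
  rw [hsplit]
  have e01 : ((b 0 - b (0 + 1) + 1 : ℤ) : ℚ) = (h : ℚ) + 1 := by
    have : (b 0 - b (0 + 1) + 1 : ℤ) = (h : ℤ) + 1 := by simp only [zero_add]; omega
    rw [this]; push_cast; ring
  have e11 : ((b 0 - b (1 + 1) + 1 : ℤ) : ℚ) = (h : ℚ) + 1 := by
    have : (b 0 - b (1 + 1) + 1 : ℤ) = (h : ℤ) + 1 := by rw [show (1:ℕ) + 1 = 2 from rfl, h12]; omega
    rw [this]; push_cast; ring
  have eN : ((b 0 : ℤ) : ℚ) = 2 * (h : ℚ) := by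
    have : (b 0 : ℤ) = 2 * (h : ℤ) := by omega
    rw [this]; push_cast; ring
  rw [show (b (0 + 1)).toNat = h from rfl, show (b (1 + 1)).toNat = h by rw [show (1:ℕ) + 1 = 2 from rfl, h12],
    e01, e11, slot_half_eq_Pface, eN]
  simp only [map_mul, map_ofNat]
  ring

/-- `P(−p) = 0` for `p ≤ 2h`, `p ≠ h`. -/
theorem Pface_eval_eq_zero {h p : ℕ} (hp : p ≤ 2 * h) (hne : p ≠ h) : (Pface h).eval (-(p : ℚ)) = 0 := by
  rw [Pface, eval_prod]
  exact prod_eq_zero (mem_erase.2 ⟨hne, mem_range.2 (by omega)⟩) (by simp)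

/-- `P(−h)⁶ = e₀(h)`. -/
theorem Pface_eval_pow_six (h : ℕ) : ((Pface h).eval (-(h : ℚ))) ^ 6 = ((e0Z (2 * h) h : ℤ) : ℚ) := by
  rw [Pface, eval_prod, ← prod_pow, e0Z]
  push_cast
  exact prod_congr rfl fun s _ => by simp only [eval_add, eval_X, eval_C]; ring

/-! ### `U` on the face -/

/-- **Closed form of the `ζ(5)`-coefficient on the face** `b = (2h; h, h, b₃, …, b₇)` (box, `Σ_j b_j ≤ 3b₀ + 1`): `U(b) · P(−h)⁴ = 2 · Q(−h)` with `P(−h) = ∏_{s ≤ 2h, s ≠ h}(s − h) ≠ 0` and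
`Q(−h) = ∏_{j=3}^{7} (−h)_{b_j} · (h − b_j + 1)_{b_j}` (the evaluated slot product). -/
theorem coeffU_face_closed (b : ℕ → ℤ) (hb : InBox b) (hsum : ∑ j ∈ range 7, b (j + 1) ≤ 3 * b 0 + 1)
    (h12 : b 2 = b 1) (h11 : 2 * b 1 = b 0) :
    coeffU b * ((Pface (b 1).toNat).eval (-(((b 1).toNat : ℕ) : ℚ))) ^ 4 =
      2 * (∏ k ∈ range 5, pochPoly 0 (b (k + 1 + 1 + 1)).toNat *
        pochPoly ((b 0 - b (k + 1 + 1 + 1) + 1 : ℤ) : ℚ) (b (k + 1 + 1 + 1)).toNat).eval (-(((b 1).toNat : ℕ) : ℚ)) := by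
  have hb1 : 0 ≤ b 1 := (hb.2 0 (by simp)).1
  obtain ⟨c, hc⟩ := exists_isPFData b hb hsum
  have hnum := numPoly_face_eq b h12 h11 hb1
  obtain ⟨h, hh⟩ : ∃ h : ℕ, (b 1).toNat = h := ⟨_, rfl⟩
  have hn : (b 0).toNat = 2 * h := by omega
  rw [hh] at hnum ⊢
  set Q : ℚ[X] := ∏ k ∈ range 5, pochPoly 0 (b (k + 1 + 1 + 1)).toNat *
        pochPoly ((b 0 - b (k + 1 + 1 + 1) + 1 : ℤ) : ℚ) (b (k + 1 + 1 + 1)).toNat with hQ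
  -- values and derivatives of the numerator at the poles
  have hval : ∀ p, p ≤ 2 * h → (numPoly b).eval (-(p : ℚ)) = 0 := by
    intro p hp
    rw [hnum]
    simp only [eval_mul, eval_pow, eval_add, eval_X, eval_C]
    by_cases hph : p = h
    · subst hph; ring
    · rw [Pface_eval_eq_zero hp hph]; ring
  have hder : ∀ p, p ≤ 2 * h → p ≠ h → (derivative (numPoly b)).eval (-(p : ℚ)) = 0 := by
    intro p hp hph
    rw [hnum]
    simp only [derivative_mul, derivative_pow, derivative_add, derivative_C, derivative_X, eval_add, eval_mul,
      eval_pow, eval_C, eval_X, eval_one, eval_zero]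
    rw [Pface_eval_eq_zero hp hph]
    ring
  have hderh : (derivative (numPoly b)).eval (-(h : ℚ)) = 2 * ((Pface h).eval (-(h : ℚ))) ^ 2 * Q.eval (-(h : ℚ)) := by
    rw [hnum]
    simp only [derivative_mul, derivative_pow, derivative_add, derivative_C, derivative_X, eval_add, eval_mul,
      eval_pow, eval_C, eval_X, eval_one, eval_zero]
    ring
  -- the top coefficients
  have he0 : ∀ p, ((e0Z (2 * h) p : ℤ) : ℚ) ≠ 0 := fun p => by exact_mod_cast e0Z_ne_zero (2 * h) p
  have hc5 : ∀ p, p ≤ 2 * h → c 5 p = 0 := by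
    intro p hp
    have h5 := (pf_top_coeffs b hc (q := p) (by omega)).1
    rw [hn, hval p hp] at h5
    exact (mul_eq_zero.1 h5).resolve_right (he0 p)
  have hc4 : ∀ p, p ≤ 2 * h → p ≠ h → c 4 p = 0 := by
    intro p hp hph
    have h4 := (pf_top_coeffs b hc (q := p) (by omega)).2
    rw [hn, hc5 p hp, zero_mul, add_zero, hder p hp hph] at h4
    exact (mul_eq_zero.1 h4).resolve_right (he0 p)
  have hc4h : c 4 h * ((e0Z (2 * h) h : ℤ) : ℚ) = 2 * ((Pface h).eval (-(h : ℚ))) ^ 2 * Q.eval (-(h : ℚ)) := by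
    have h4 := (pf_top_coeffs b hc (q := h) (by omega)).2
    rw [hn, hc5 h (by omega), zero_mul, add_zero, hderh] at h4
    exact h4
  -- U = c_{4,h}
  have hU : coeffU b = c 4 h := by
    rw [coeffU_eq hc, hn, sum_eq_single h]
    · intro p hp hph; exact hc4 p (Nat.lt_succ_iff.1 (mem_range.1 hp)) hph
    · intro hnot; exact absurd (mem_range.2 (by omega)) hnot
  rw [hU]
  have hP0 : (Pface h).eval (-(h : ℚ)) ≠ 0 := by
    rw [Pface, eval_prod]
    exact prod_ne_zero_iff.2 fun s hs => by
      have := (mem_erase.1 hs).1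
      simp only [eval_add, eval_X, eval_C]
      intro h0
      apply this
      have : (s : ℚ) = h := by linarith
      exact_mod_cast this
  rw [← Pface_eval_pow_six] at hc4h
  have := mul_right_cancel₀ (pow_ne_zero 2 hP0) (show c 4 h * ((Pface h).eval (-(h : ℚ))) ^ 4 * ((Pface h).eval (-(h : ℚ))) ^ 2 =
    (2 * Q.eval (-(h : ℚ))) * ((Pface h).eval (-(h : ℚ))) ^ 2 by linear_combination hc4h)
  exact this

end LevelDescent

end Summit.KontsevichZagierPeriods.Zeta5Search.WedgeDictionary
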